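import Summits.HodgeConjecture.HodgeConjecture.Theorems.Ring2MotivRibetTypeCells
import Literature.AlgebraicGeometry.HodgeTheory.RealMultiplicationPowersHodgeClasses
import HarnessLib

/-!
# Ring 2 · route `motiv` (generation 95) — the FACT-FREE COMPANION of the `r = 1` Ribet-type row (a helper beside `Ring2MotivRibetTypeCells` §5; the mathematics is the `lit` seat's tree theorem — count once `lit`'s) — `HC_CM` ABSENT, NO named fact

HONEST FRAMING: research route conditional on HC_CM; not a corollary; Q11.4-sentence-2 already refuted in dim ≥ 3.

Cell `pub-hodge-ring2`, seat `pub-hodge-ring2-motiv-g95`. ONE theorem, filed on the cell LEAD's word (LEAD gen 72, ruling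
L72.2 (e) (2), RING2-MAP `§LEAD (gen 72)`): «a fact-free COMPANION theorem of the `r = 1` row is AUTHORISED AS OPTIONAL, NOT OWED —
one `Theorems/Ring2*` helper, a new theorem name beside the row (the row as filed keeps its binder; no re-file of a landed row /
`_holds`), no new axis module, no leaf discharge, no RING2-MAP row edit beyond status words, COUNT ONCE lit's».

THE ROW (landed 2026-08-19, Literature side, this route's feeder file `Literature/AlgebraicGeometry/HodgeTheory/RibetTotallyRealHodgeClasses.lean`
§3): `HodgeTheory.hodgeConjectureFor_powSucc_of_totallyReal_rank_eq_dim (h : Ribet1983_hodgeClasses_divisorial_powers_totallyRealField_oddRelDim)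
(A) (hF : IsField End⁰(A)) (hT : End⁰(A) totally real) (he : finrank_ℚ End⁰(A) = dim A) (N) : HodgeConjectureFor (A^{N+1}).dim (A^{N+1}).X`
— the Hodge conjecture for every power of a complex abelian variety whose endomorphism algebra is a totally real field of degree
`dim A` (type I, relative dimension one: Ribet 1983 Thm. 1 with Thm. 0, Gordon 1997 Thm. 6.3), MODULO the named print fact (Ribet's
theorem for ALL odd relative dimensions, a HYPOTHESIS `h`).

THE COMPANION (this file, `Ring2.Motiv.hodgeConjectureFor_powSucc_of_totallyReal_rank_eq_dim_factFree`): the SAME statement, binder for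
binder, WITHOUT the fact binder — a one-line re-export BY NAME of the `lit` seat's unconditional assembly
`HodgeTheory.hodgeConjectureFor_powSucc_of_isTotallyReal_finrank_eq_dim` (`Literature/AlgebraicGeometry/HodgeTheory/RealMultiplicationPowersHodgeClasses.lean`,
p260316 ACCEPTED 2514ada58c81: Ribet's Thm. 0 at relative dimension one PROVED in the tree — the Lie step in the word model
(`AVSlots.exists_rmInvariant_coeff`), the cycle side `RealMultiplicationDivisorClasses`, and this route's unconditional
`hodgeConjectureFor_of_isDivisorGenerated` from `HodgeGroupProductCMFactorClasses`). The mathematics is Ribet's / Hazama's and the tree proof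
is the `lit` seat's; this file only places the fact-free form beside this route's row under a row-shaped name on the Summits side (the cell's
LEAN PLACEMENT RULE: compositions of the cell live under `Summits/`, the Literature theorem stays the ingredient), so that the cell's tables
can cite ONE name for «`r = 1`: fact-free».

WHAT DOES NOT CHANGE. The row as filed keeps its binder — its term at ANY witness `h` of the fact IS the companion (proof irrelevance;
checked below as an `example`, not a re-file). The named fact `Ribet1983_hodgeClasses_divisorial_powers_totallyRealField_oddRelDim` (all odd
`r`) is NOT discharged: it stays load-bearing for the odd `r ≥ 3` rows (`HodgeTheory.hodgeConjectureFor_powSucc_sixfold_realQuadratic_of_ribet1983`,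
`HodgeTheory.hodgeConjectureFor_powSucc_of_endAlgebra_rank_one_of_odd`, the class row `Ring2.Motiv.hcOnClass_totallyRealOddPowerClass_of_ribet1983`).
`HC_CM` (the tree item `Theses.RankFourFaces.CMAbelianHodge`) does not occur in this file; no class target, no node, no definition is
introduced; this route's axis of record (23 modules / 295 declarations) is unchanged — the helper sits outside it. No transport / deformation /
semiregularity is used: the Q11.4 no-go does not bear.

ON PATH: the conclusion is `HodgeConjectureFor X.dim X.X` for a complex abelian variety `X = A^{N+1}` — a case of `HC_AV`
(`Theses.PadicSemiregularLift.HodgeAbelianVarieties`) and of the summit; the `r = 1` abelian varieties are members (`r := 1`) of the landed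
isogeny-closed class `Ring2.Motiv.TotallyRealOddPowerClass`, whose on-path rows `hcOnClass_totallyRealOddPowerClass_of_hodgeAbelianVarieties` /
`…_of_hodgeConjecture` are landed (`Ring2MotivRibetTypeCells` §5); both facts are re-checked below as `example`s, nothing restated.

References: [Ribet1983] K. A. Ribet, Hodge classes on certain types of abelian varieties, Amer. J. Math. 105 (1983), Thms. 0–1 (pp. 523–525);
[Hazama1983] F. Hazama, Hodge cycles on abelian varieties of CM type, Thm. (1.1); [Gordon1997] B. B. Gordon, A survey of the Hodge conjecture
for abelian varieties, Thm. 6.3 (arXiv:alg-geom/9709030); [Deligne2000] §1.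
-/

set_option linter.dupNamespace false

namespace Summit.HodgeConjecture.HodgeConjecture.Ring2.Motiv

open Literature.AlgebraicGeometry Literature.AlgebraicGeometry.Motives
open Literature.AlgebraicGeometry.HodgeTheory
open Literature.AlgebraicGeometry.ComplexMultiplication (EndField)
open Summit.HodgeConjecture.HodgeConjecture.Theses

/-- **FACT-FREE companion of the `r = 1` Ribet-type row: every power `A^{N+1}` of a complex abelian variety `A` whose endomorphism
algebra `End⁰(A)` is a totally real field of degree `dim A` satisfies the Hodge conjecture** — unconditionally: no named fact, no `HC_CM`.
Binder for binder the type of the landed row `HodgeTheory.hodgeConjectureFor_powSucc_of_totallyReal_rank_eq_dim` minus its leading fact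
binder; the proof is the `lit` seat's tree theorem `HodgeTheory.hodgeConjectureFor_powSucc_of_isTotallyReal_finrank_eq_dim` (Ribet 1983
Thm. 0 at relative dimension one, proved in `RealMultiplicationPowersHodgeClasses`), by name. Count once `lit`'s.
[cite: Ribet1983, Thm. 0–1 (pp. 523–525)] [cite: Hazama1983, Thm. (1.1)] [cite: Gordon1997, Thm. 6.3] -/
theorem hodgeConjectureFor_powSucc_of_totallyReal_rank_eq_dim_factFree
    (A : AbelianVariety ℂ) (hF : IsField A.endAlgebra) (hT : NumberField.IsTotallyReal (EndField A hF))
    (he : Module.finrank ℚ A.endAlgebra = A.dim) (N : ℕ) :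
    HodgeConjectureFor (A.powSucc N).dim (A.powSucc N).X :=
  hodgeConjectureFor_powSucc_of_isTotallyReal_finrank_eq_dim A hF hT he N

/-- The landed row at any witness `h` of the named fact IS the companion (same type behind the fact binder; proof irrelevance) —
the row is not re-filed and keeps its binder. -/
example (h : Ribet1983_hodgeClasses_divisorial_powers_totallyRealField_oddRelDim) :
    hodgeConjectureFor_powSucc_of_totallyReal_rank_eq_dim h
      = hodgeConjectureFor_powSucc_of_totallyReal_rank_eq_dim_factFree := rfl

/-- The `r = 1` abelian varieties are the `r := 1` members of the landed typed packet `IsTotallyRealOddWith` (so their powers lie in the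
isogeny-closed class `TotallyRealOddPowerClass` of `Ring2MotivRibetTypeCells` §5). -/
example (A : AbelianVariety ℂ) (hF : IsField A.endAlgebra) (hT : NumberField.IsTotallyReal (EndField A hF))
    (he : Module.finrank ℚ A.endAlgebra = A.dim) : IsTotallyRealOddWith A hF 1 :=
  ⟨hT, by rw [he, mul_one], odd_one⟩

/-- ON PATH: the companion's conclusion is a case of `HC_AV` … -/
example (hAV : PadicSemiregularLift.HodgeAbelianVarieties) (A : AbelianVariety ℂ) (N : ℕ) :
    HodgeConjectureFor (A.powSucc N).dim (A.powSucc N).X :=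
  hAV (A.powSucc N)

/-- … and of the summit statement. -/
example (h : _root_.HodgeConjecture) (A : AbelianVariety ℂ) (N : ℕ) :
    HodgeConjectureFor (A.powSucc N).dim (A.powSucc N).X :=
  h (AbelianVariety.isSmoothProjective_holds (A := A.powSucc N))

end Summit.HodgeConjecture.HodgeConjecture.Ring2.Motiv
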